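import Mathlib
import HarnessLib
import HarnessLib.Audit
import Summits.KontsevichZagierPeriods.Zeta5Search.Denom.CatalanRayIntegralityBridge

/-!
# Catalan rays — the ray `j = 3` at `n = 2`: a kernel witness against the multiplier `d*_{4n} · d*_{3n}`

Cell `pub-zeta5`, fam-denom (service lane, gen 4).
HONEST FRAMING: systematic search; no irrationality claim unless certified.  Nothing here concerns the
irrationality of `G`.

fam-catalan's hypothesis schema `RayIntegrality j` clears the rational part with
`rayMult j n = d*_{(j+1)n} · d*_{jn} · 2^{2(2j+1)n}`.  fam-denom's Theorem K6 (`rayPClosed_oddInt`) gives, on every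
ray `j ≥ 3`, the odd envelope `d*_{(j+1)n} · d*_{max(jn, 4n−1)}` — equal to fam-catalan's for `j ≥ 4`
(`rayPClosed_isInt`, `rayIntegrality_of_identification`) but STRICTLY LARGER at `j = 3` (`d*_{4n−1}` versus
`d*_{3n}`).  This file shows the difference is real: the kernel evaluates the closed form at `j = 3`, `n = 2`,
`rayPClosed 3 2 = PClosed 2 6 = −337630511887 / 10276044800` (`10276044800 = 2²³·5²·7²`), whose `7`-adic
valuation is `−2`, while `d*_8 · d*_6 = 105 · 15` carries only `7¹`.  Hence `rayMult 3 2 · rayPClosed 3 2 ∉ ℤ`, and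
GIVEN the identification node at `j = 3` (`RayIdentification 3`, hypothesis schema of
`Denom/CatalanRayIntegralityBridge`), fam-catalan's `RayIntegrality 3` is false: the `j = 3` ray cannot be run with
that multiplier (fam-catalan's files already mark `j = 3` as "expected to fail"; this makes it a theorem modulo the
identification).  Our own bound is respected: `v₇ = −2 = −(⌊log₇ 8⌋ + ⌊log₇ 7⌋)`, tight.

* `PClosed_two_six`, `rayPClosed_three_two` — the kernel value (heavy `norm_num`, ≈ 2 min);
* `padicValRat_seven_rayPClosed_three_two : padicValRat 7 (rayPClosed 3 2) = -2`;
* `rayMult_three_two_not_int : ¬ ∃ z : ℤ, z = rayMult 3 2 * rayPClosed 3 2`;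
* `not_rayIntegrality_three : RayIdentification 3 → ¬ RayIntegrality 3`.
-/

namespace Summit.KontsevichZagierPeriods.Zeta5Search.Denom.CatalanRayPClosed

open Summit.KontsevichZagierPeriods.Zeta5Search.Denom.CatalanRayAtoms
open Summit.KontsevichZagierPeriods.Zeta5Search.CatalanTwoAdicSeries (rayQ rayMult rayMult_ne_zero RayIntegrality)

set_option maxHeartbeats 8000000 in
/-- kernel value on the ray `j = 3`, `n = 2` (= `d9/pclosed.py PClosed(2,6)` = `k6/shiftrep.PQ(2,6,2,8,2,2)[0]`;
`10276044800 = 2²³·5²·7²`). Heavy: `norm_num` with a raised `maxSteps`. -/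
theorem PClosed_two_six : PClosed 2 6 = -337630511887 / 10276044800 := by
  norm_num (config := { maxSteps := 8000000 }) [PClosed, termA, termBB, termBA, termG, coef, K0, Nnum, D1, D2, skip,
    logDer, tB, gsumAtom, Watom, wTerm, wInc₁, wInc₂, sigmaAtom, Finset.sum_range_succ, Finset.prod_range_succ,
    Finset.sum_Icc_succ_top, Nat.choose_succ_succ, Nat.factorial]

/-- `rayPClosed 3 2 = −337630511887 / 10276044800`. -/
theorem rayPClosed_three_two : rayPClosed 3 2 = -337630511887 / 10276044800 := PClosed_two_six

/-- `v₇(rayPClosed 3 2) = −2` (tight for fam-denom's envelope `d*_8 · d*_7`; one below fam-catalan's `d*_8 · d*_6`). -/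
theorem padicValRat_seven_rayPClosed_three_two : padicValRat 7 (rayPClosed 3 2) = -2 := by
  haveI : Fact (Nat.Prime 7) := ⟨by norm_num⟩
  have h1 : padicValRat 7 (337630511887 : ℚ) = 0 := by
    rw [show (337630511887 : ℚ) = ((337630511887 : ℕ) : ℚ) by norm_cast, padicValRat.of_nat]
    exact_mod_cast padicValNat.eq_zero_of_not_dvd (by norm_num)
  have h2 : padicValRat 7 (209715200 : ℚ) = 0 := by
    rw [show (209715200 : ℚ) = ((209715200 : ℕ) : ℚ) by norm_cast, padicValRat.of_nat]
    exact_mod_cast padicValNat.eq_zero_of_not_dvd (by norm_num)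
  have h7 : padicValRat 7 (7 : ℚ) = 1 := by
    have h := padicValRat.self (p := 7) (by norm_num)
    exact_mod_cast h
  rw [rayPClosed_three_two,
    show (-337630511887 / 10276044800 : ℚ) = -(337630511887 / 209715200 / 7 ^ 2) by norm_num, padicValRat.neg,
    padicValRat.div (by norm_num) (by norm_num), padicValRat.div (by norm_num) (by norm_num),
    padicValRat.pow, h7, h1, h2]
  norm_num

/-- `v₇(rayMult 3 2) = ⌊log₇ 8⌋ + ⌊log₇ 6⌋ + 28·v₇(2) = 1`. -/
theorem padicValRat_seven_rayMult_three_two : padicValRat 7 (rayMult 3 2) = 1 := by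
  haveI : Fact (Nat.Prime 7) := ⟨by norm_num⟩
  have hpos : ∀ N, 0 < dstarOdd N := fun N => by
    unfold dstarOdd; exact Finset.prod_pos (fun p hp => pow_pos (Finset.mem_filter.mp hp).2.1.pos _)
  have hne : ∀ N, (dstarOdd N : ℚ) ≠ 0 := fun N => by exact_mod_cast (hpos N).ne'
  rw [rayMult_eq, Nat.cast_mul, padicValRat.mul (mul_ne_zero (hne _) (hne _)) (pow_ne_zero _ two_ne_zero),
    padicValRat.mul (hne _) (hne _), padicValRat_dstarOdd (by norm_num), padicValRat_dstarOdd (by norm_num),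
    padicValRat.pow, v_two (by norm_num), mul_zero, add_zero]
  have hl1 : Nat.log 7 ((3 + 1) * 2) = 1 := by
    rw [Nat.log_eq_iff (Or.inl one_ne_zero)]; norm_num
  have hl2 : Nat.log 7 (3 * 2) = 0 := Nat.log_of_lt (by norm_num)
  rw [hl1, hl2]; norm_num

/-- **`rayMult 3 2 · rayPClosed 3 2` is not an integer** (`7`-adic valuation `1 − 2 = −1`). -/
theorem rayMult_three_two_not_int : ¬ ∃ z : ℤ, (z : ℚ) = rayMult 3 2 * rayPClosed 3 2 := by
  haveI : Fact (Nat.Prime 7) := ⟨by norm_num⟩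
  rintro ⟨z, hz⟩
  have hP : rayPClosed 3 2 ≠ 0 := by rw [rayPClosed_three_two]; norm_num
  have hM : rayMult 3 2 ≠ 0 := rayMult_ne_zero 3 2
  have hv : (0 : ℤ) ≤ padicValRat 7 (z : ℚ) := by
    rw [padicValRat.of_int]; exact_mod_cast Nat.zero_le _
  rw [hz, padicValRat.mul hM hP, padicValRat_seven_rayMult_three_two, padicValRat_seven_rayPClosed_three_two] at hv
  norm_num at hv

/-- **Given the identification node at `j = 3`, fam-catalan's `RayIntegrality 3` is false**: the `j = 3` ray cannot
be cleared by `d*_{4n} · d*_{3n} · 2^{14n}` (witness `n = 2`, prime `7`). -/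
theorem not_rayIntegrality_three (hId : RayIdentification 3) : ¬ RayIntegrality 3 := fun hRI =>
  rayMult_three_two_not_int (hRI 2 (by norm_num) (rayPClosed 3 2) (hId 2 (by norm_num)))

end Summit.KontsevichZagierPeriods.Zeta5Search.Denom.CatalanRayPClosed
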